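import Literature.NumberTheory.Transcendental.PreBlochGroupProofs
import HarnessLib

/-!
# Extended symbols `⟦z⟧ ∈ P(F)` and the five-term relation at a place

Second step towards Dupont, *Scissors congruences, group homology and characteristic classes*
(2001), Thm. 8.16 (unique divisibility of `P(F)`, `F` algebraically closed of characteristic `0`;
named fact `Suslin1991_preBloch_isUniquelyDivisible` of `PreBlochGroup.lean`), following the
printed proof (Dupont pp. 42–43 after Dupont–Sah, *Scissors congruences II* (1982), §5): the proof
of "Rogers' identity" (Dupont Thm. 8.14 = Dupont–Sah Thm. 5.14) evaluates rational functions
`f ∈ F(t)` at `t = 0` and `t = ∞` with the convention `{0} = {1} = {∞} = 0` and uses that the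
five-term relation "remains valid for `zᵢ ∈ F ∪ {∞}`" (Dupont p. 43; Dupont–Sah p. 167: "we can
extend the definition of `{z} ∈ P_F` allowing `{z}` with `z ∈ P¹(F) = F ∪ {∞}` and dropping
restrictions on `z₁` and `z₂` in (5.3)", and p. 171: "the analogous equations with `L` replaced by
`R` follow directly from the extended form of (5.3)").

## Contents

* `PreBloch.sym z = ⟦z⟧`: the extended symbol of an arbitrary `z ∈ F` (`[z]` off `{0,1}`, else `0`),
  with the six-fold symmetry over an algebraically closed field (`sym_inv`, `sym_one_sub`, …) and
  the five-term relation at a non-degenerate pair (`sym_five_term`).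
* `PreBloch.IsPlace K F Reg ev`: an abstract place of a field `K` with residue values in `F`
  (`Reg` = the valuation ring, `ev` = residue map, a ring homomorphism on `Reg`; `x` or `x⁻¹`
  regular; regular elements of non-zero value are units), and `PreBloch.placeSym Reg ev x`, the
  symbol `⟦x(𝔭)⟧` of `x ∈ K` at the place (`0` at a pole). [folklore]
* `PreBloch.IsPlace.five_term`: **the five-term relation specializes at a place** over an
  algebraically closed `F`: for `x, y ∈ K ∖ {0}`, `y ≠ 1`,
  `⟦x(𝔭)⟧ - ⟦y(𝔭)⟧ + ⟦(y/x)(𝔭)⟧ - ⟦((1-x⁻¹)/(1-y⁻¹))(𝔭)⟧ + ⟦((1-x)/(1-y))(𝔭)⟧ = 0`, by the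
  seventeen-case analysis of the residues (`ft_gg_ne`, …, `ft_pp`): the generic case is the
  five-term relation in `P(F)`, the degenerate cases reduce to `⟦u⟧ + ⟦u⁻¹⟧ = 0`,
  `⟦u⟧ + ⟦1-u⟧ = 0` and their consequences (`PreBlochGroupProofs.lean`).

Used in the sequel for the places `t = 0` and `t = ∞` of `F(t)`.

## References

* J. L. Dupont, *Scissors congruences, group homology and characteristic classes*, World
  Scientific 2001: (8.13), Thm. 8.14, p. 43. [Dupont2001]
* J. L. Dupont, C.-H. Sah, *Scissors congruences II*, J. Pure Appl. Algebra 25 (1982) 159–195: §5,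
  (5.3) extended, Thm. 5.14 and its proof. [DupontSah1982]
* W. D. Neumann, Geom. Topol. Monogr. 1 (1998), eq. (2.3). [Neumann1998]
-/

noncomputable section

namespace Literature.NumberTheory.Transcendental

namespace PreBloch

variable {F : Type*} [Field F]

/-- The **extended symbol** `⟦z⟧ ∈ P(F)` of an arbitrary `z ∈ F`: the class `[z]` for
`z ∉ {0, 1}` and `0` for `z ∈ {0, 1}` (Dupont: "We can then introduce the symbols
`{0} = {1} = {∞} = 0`"; Dupont–Sah §5: "we have done nothing more than setting
`{∞} = {0} = {1} = 0`"). [cite: Dupont2001, p. 43] -/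
def sym (z : F) : PreBloch F := by
  classical
  exact if h : z ≠ 0 ∧ z ≠ 1 then PreBloch.mk z h else 0

/-- The extended symbol of `z ∉ {0,1}` is the class `[z]`. [folklore] -/
theorem sym_of_ne {z : F} (h : z ≠ 0 ∧ z ≠ 1) : sym z = PreBloch.mk z h := by
  unfold sym
  rw [dif_pos h]

/-- The extended symbol of `z ∈ {0,1}` is `0`. [folklore] -/
theorem sym_of_not {z : F} (h : ¬(z ≠ 0 ∧ z ≠ 1)) : sym z = 0 := by
  unfold sym
  rw [dif_neg h]

/-- `⟦0⟧ = 0`. [folklore] -/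
@[simp] theorem sym_zero : sym (0 : F) = 0 := sym_of_not (by simp)

/-- `⟦1⟧ = 0`. [folklore] -/
@[simp] theorem sym_one : sym (1 : F) = 0 := sym_of_not (by simp)

/-- `⟦z⟧ + ⟦z⁻¹⟧ = 0` for every `z` (alg. closed). [cite: Dupont2001, (8.13 ii)] -/
theorem sym_add_sym_inv [IsAlgClosed F] (z : F) : sym z + sym z⁻¹ = 0 := by
  by_cases h0 : z = 0
  · simp [h0]
  by_cases h1 : z = 1
  · simp [h1]
  rw [sym_of_ne ⟨h0, h1⟩, sym_of_ne (ne_inv ⟨h0, h1⟩)]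
  exact mk_add_mk_inv rfl ⟨h0, h1⟩ (ne_inv ⟨h0, h1⟩)

/-- `⟦z⁻¹⟧ = -⟦z⟧`. [cite: Dupont2001, (8.13 ii)] -/
theorem sym_inv [IsAlgClosed F] (z : F) : sym z⁻¹ = -sym z :=
  eq_neg_of_add_eq_zero_right (sym_add_sym_inv z)

/-- `⟦z⟧ + ⟦1 - z⟧ = 0` for every `z`. [cite: Dupont2001, (8.13 iii)] -/
theorem sym_add_sym_one_sub [IsAlgClosed F] (z : F) : sym z + sym (1 - z) = 0 := by
  by_cases h0 : z = 0
  · simp [h0]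
  by_cases h1 : z = 1
  · simp [h1]
  rw [sym_of_ne ⟨h0, h1⟩, sym_of_ne (ne_one_sub ⟨h0, h1⟩)]
  exact mk_add_mk_one_sub rfl ⟨h0, h1⟩ (ne_one_sub ⟨h0, h1⟩)

/-- `⟦1 - z⟧ = -⟦z⟧`. [cite: Dupont2001, (8.13 iii)] -/
theorem sym_one_sub [IsAlgClosed F] (z : F) : sym (1 - z) = -sym z :=
  eq_neg_of_add_eq_zero_right (sym_add_sym_one_sub z)

/-- `⟦1 - z⁻¹⟧ = ⟦z⟧`. [cite: Dupont2001, (8.13)] -/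
theorem sym_one_sub_inv [IsAlgClosed F] (z : F) : sym (1 - z⁻¹) = sym z := by
  rw [sym_one_sub, sym_inv, neg_neg]

/-- `⟦(1 - z)⁻¹⟧ = ⟦z⟧`. [cite: Dupont2001, (8.13)] -/
theorem sym_inv_one_sub [IsAlgClosed F] (z : F) : sym (1 - z)⁻¹ = sym z := by
  rw [sym_inv, sym_one_sub, neg_neg]

/-- `⟦z / (z - 1)⟧ = -⟦z⟧`. [cite: Dupont2001, (8.13)] -/
theorem sym_div_sub_one [IsAlgClosed F] (z : F) : sym (z / (z - 1)) = -sym z := by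
  by_cases h0 : z = 0
  · simp [h0]
  have : z / (z - 1) = (1 - z⁻¹)⁻¹ := by
    rw [one_sub_inv_eq_div h0, inv_div]
  rw [this, sym_inv, sym_one_sub_inv]

/-- `⟦z / (z - 1)⟧`, multiplicative form: `⟦z (z - 1)⁻¹⟧ = -⟦z⟧`. [cite: Dupont2001, (8.13)] -/
theorem sym_mul_inv_sub_one [IsAlgClosed F] (z : F) : sym (z * (z - 1)⁻¹) = -sym z := by
  rw [← div_eq_mul_inv, sym_div_sub_one]

/-- The five-term relation for extended symbols at a non-degenerate pair. [cite: Neumann1998, eq. (2.3)] -/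
theorem sym_five_term {a b : F} (ha : a ≠ 0 ∧ a ≠ 1) (hb : b ≠ 0 ∧ b ≠ 1) (hab : a ≠ b) :
    sym a - sym b + sym (b / a) - sym ((1 - a⁻¹) / (1 - b⁻¹)) + sym ((1 - a) / (1 - b)) = 0 := by
  have h3 : b / a ≠ 0 ∧ b / a ≠ 1 :=
    ⟨(Gen.quot ⟨a, ha⟩ ⟨b, hb⟩ hab).val_ne_zero, (Gen.quot ⟨a, ha⟩ ⟨b, hb⟩ hab).val_ne_one⟩
  have h4 : (1 - a⁻¹) / (1 - b⁻¹) ≠ 0 ∧ (1 - a⁻¹) / (1 - b⁻¹) ≠ 1 :=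
    ⟨(Gen.quotInv ⟨a, ha⟩ ⟨b, hb⟩ hab).val_ne_zero, (Gen.quotInv ⟨a, ha⟩ ⟨b, hb⟩ hab).val_ne_one⟩
  have h5 : (1 - a) / (1 - b) ≠ 0 ∧ (1 - a) / (1 - b) ≠ 1 :=
    ⟨(Gen.quotSub ⟨a, ha⟩ ⟨b, hb⟩ hab).val_ne_zero, (Gen.quotSub ⟨a, ha⟩ ⟨b, hb⟩ hab).val_ne_one⟩
  rw [sym_of_ne ha, sym_of_ne hb, sym_of_ne h3, sym_of_ne h4, sym_of_ne h5]
  exact five_term_eq ha hb hab rfl rfl rfl h3 h4 h5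

/-! ### Places -/

/-- An (abstract) **place** of a field `K` with values in a field `F`: a predicate `Reg`
("regular at the place", the valuation ring) and a map `ev` ("value at the place") which is a ring
homomorphism on `Reg`, such that `x` or `x⁻¹` is regular for every `x`, and regular elements with
non-zero value are units. The symbol of `x` at the place is `⟦ev x⟧` if `x` is regular and
`⟦∞⟧ = 0` otherwise. [folklore] -/
structure IsPlace (K F : Type*) [Field K] [Field F] (Reg : K → Prop) (ev : K → F) : Prop where
  reg_one : Reg 1
  ev_one : ev 1 = 1
  reg_add : ∀ {x y : K}, Reg x → Reg y → Reg (x + y)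
  ev_add : ∀ {x y : K}, Reg x → Reg y → ev (x + y) = ev x + ev y
  reg_neg : ∀ {x : K}, Reg x → Reg (-x)
  ev_neg : ∀ {x : K}, Reg x → ev (-x) = -ev x
  reg_mul : ∀ {x y : K}, Reg x → Reg y → Reg (x * y)
  ev_mul : ∀ {x y : K}, Reg x → Reg y → ev (x * y) = ev x * ev y
  reg_or_reg_inv : ∀ x : K, Reg x ∨ Reg x⁻¹
  reg_inv : ∀ {x : K}, Reg x → ev x ≠ 0 → Reg x⁻¹

/-- The symbol of `x ∈ K` at a place: `⟦ev x⟧` if `x` is regular, `⟦∞⟧ = 0` otherwise.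
[cite: DupontSah1982, §5] -/
def placeSym {K : Type*} (Reg : K → Prop) (ev : K → F) (x : K) : PreBloch F := by
  classical
  exact if Reg x then sym (ev x) else 0

/-- At a regular element the symbol at the place is `⟦ev x⟧`. [folklore] -/
theorem placeSym_of_reg {K : Type*} {Reg : K → Prop} {ev : K → F} {x : K} (h : Reg x) :
    placeSym Reg ev x = sym (ev x) := by
  unfold placeSym
  rw [if_pos h]

/-- At a pole the symbol at the place is `⟦∞⟧ = 0`. [folklore] -/
theorem placeSym_of_not_reg {K : Type*} {Reg : K → Prop} {ev : K → F} {x : K} (h : ¬Reg x) :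
    placeSym Reg ev x = 0 := by
  unfold placeSym
  rw [if_neg h]

/-- The symbol at the place vanishes when the value is `0` or `1`. [folklore] -/
theorem placeSym_eq_zero_of_ev {K : Type*} {Reg : K → Prop} {ev : K → F} {x : K}
    (h : ev x = 0 ∨ ev x = 1) : placeSym Reg ev x = 0 := by
  by_cases hx : Reg x
  · rw [placeSym_of_reg hx]
    rcases h with h | h <;> simp [h]
  · exact placeSym_of_not_reg hx

namespace IsPlace

variable {K : Type*} [Field K] {Reg : K → Prop} {ev : K → F}

/-- `0` is regular. [folklore] -/
theorem reg_zero (hP : IsPlace K F Reg ev) : Reg 0 := by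
  simpa using hP.reg_add hP.reg_one (hP.reg_neg hP.reg_one)

/-- The value of `0` is `0`. [folklore] -/
theorem ev_zero (hP : IsPlace K F Reg ev) : ev 0 = 0 := by
  have h := hP.ev_add hP.reg_zero hP.reg_zero
  simpa using h

/-- Regular elements are closed under subtraction. [folklore] -/
theorem reg_sub (hP : IsPlace K F Reg ev) {x y : K} (hx : Reg x) (hy : Reg y) : Reg (x - y) := by
  simpa [sub_eq_add_neg] using hP.reg_add hx (hP.reg_neg hy)

/-- The value map is additive (subtraction). [folklore] -/
theorem ev_sub (hP : IsPlace K F Reg ev) {x y : K} (hx : Reg x) (hy : Reg y) :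
    ev (x - y) = ev x - ev y := by
  rw [sub_eq_add_neg, hP.ev_add hx (hP.reg_neg hy), hP.ev_neg hy, ← sub_eq_add_neg]

/-- `1 - x` is regular when `x` is. [folklore] -/
theorem reg_one_sub (hP : IsPlace K F Reg ev) {x : K} (hx : Reg x) : Reg (1 - x) :=
  hP.reg_sub hP.reg_one hx

/-- `ev (1 - x) = 1 - ev x` for regular `x`. [folklore] -/
theorem ev_one_sub (hP : IsPlace K F Reg ev) {x : K} (hx : Reg x) : ev (1 - x) = 1 - ev x := by
  rw [hP.ev_sub hP.reg_one hx, hP.ev_one]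

/-- `x` is regular when `1 - x` is. [folklore] -/
theorem reg_of_reg_one_sub (hP : IsPlace K F Reg ev) {x : K} (hx : Reg (1 - x)) : Reg x := by
  simpa using hP.reg_sub hP.reg_one hx

/-- `1 - x` has a pole when `x` has. [folklore] -/
theorem not_reg_one_sub (hP : IsPlace K F Reg ev) {x : K} (hx : ¬Reg x) : ¬Reg (1 - x) :=
  fun h => hx (hP.reg_of_reg_one_sub h)

/-- A regular element with non-zero value is a unit: `ev x⁻¹ = (ev x)⁻¹`. [folklore] -/
theorem ev_inv (hP : IsPlace K F Reg ev) {x : K} (hx : Reg x) (hx0 : ev x ≠ 0) :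
    ev x⁻¹ = (ev x)⁻¹ := by
  have hxne : x ≠ 0 := by
    rintro rfl
    exact hx0 hP.ev_zero
  have h := hP.ev_mul hx (hP.reg_inv hx hx0)
  rw [mul_inv_cancel₀ hxne, hP.ev_one] at h
  exact (eq_inv_of_mul_eq_one_right h.symm)

/-- An element of the maximal ideal has a non-regular inverse. [folklore] -/
theorem not_reg_inv (hP : IsPlace K F Reg ev) {x : K} (hx : Reg x) (hx0 : ev x = 0) (hxne : x ≠ 0) :
    ¬Reg x⁻¹ := by
  intro h
  have h1 := hP.ev_mul hx h
  rw [mul_inv_cancel₀ hxne, hP.ev_one, hx0, zero_mul] at h1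
  exact one_ne_zero h1

/-- A non-regular element has an inverse in the maximal ideal. [folklore] -/
theorem reg_inv_of_not_reg (hP : IsPlace K F Reg ev) {x : K} (hx : ¬Reg x) : Reg x⁻¹ :=
  (hP.reg_or_reg_inv x).resolve_left hx

/-- The inverse of a pole lies in the maximal ideal. [folklore] -/
theorem ev_inv_of_not_reg (hP : IsPlace K F Reg ev) {x : K} (hx : ¬Reg x) : ev x⁻¹ = 0 := by
  by_contra h
  have := hP.reg_inv (hP.reg_inv_of_not_reg hx) h
  rw [inv_inv] at this
  exact hx this

/-- A pole is non-zero. [folklore] -/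
theorem ne_zero_of_not_reg (hP : IsPlace K F Reg ev) {x : K} (hx : ¬Reg x) : x ≠ 0 := by
  rintro rfl
  exact hx hP.reg_zero

/-- pole · unit = pole [folklore] -/
theorem not_reg_mul_of_not_reg_of_unit (hP : IsPlace K F Reg ev) {x y : K} (hx : ¬Reg x)
    (hy : Reg y) (hy0 : ev y ≠ 0) : ¬Reg (x * y) := by
  intro h
  have hyne : y ≠ 0 := by
    rintro rfl
    exact hy0 hP.ev_zero
  have : x = x * y * y⁻¹ := by rw [mul_assoc, mul_inv_cancel₀ hyne, mul_one]
  exact hx (this ▸ hP.reg_mul h (hP.reg_inv hy hy0))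

/-- pole · pole = pole [folklore] -/
theorem not_reg_mul_of_not_reg (hP : IsPlace K F Reg ev) {x y : K} (hx : ¬Reg x) (hy : ¬Reg y) :
    ¬Reg (x * y) := by
  intro h
  have hxne := hP.ne_zero_of_not_reg hx
  have hyne := hP.ne_zero_of_not_reg hy
  have h1 := hP.ev_mul h (hP.reg_mul (hP.reg_inv_of_not_reg hx) (hP.reg_inv_of_not_reg hy))
  rw [show x * y * (x⁻¹ * y⁻¹) = 1 by field_simp, hP.ev_one,
    hP.ev_mul (hP.reg_inv_of_not_reg hx) (hP.reg_inv_of_not_reg hy), hP.ev_inv_of_not_reg hx,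
    zero_mul, mul_zero] at h1
  exact one_ne_zero h1

/-- pole / unit = pole [folklore] -/
theorem not_reg_div_of_not_reg_of_unit (hP : IsPlace K F Reg ev) {x y : K} (hx : ¬Reg x)
    (hy : Reg y) (hy0 : ev y ≠ 0) : ¬Reg (x / y) := by
  rw [div_eq_mul_inv]
  refine hP.not_reg_mul_of_not_reg_of_unit hx (hP.reg_inv hy hy0) ?_
  rw [hP.ev_inv hy hy0]
  exact inv_ne_zero hy0

/-- unit / pole ∈ m, regular / pole ∈ m [folklore] -/
theorem reg_div_of_not_reg (hP : IsPlace K F Reg ev) {x y : K} (hx : Reg x) (hy : ¬Reg y) :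
    Reg (x / y) ∧ ev (x / y) = 0 := by
  rw [div_eq_mul_inv]
  exact ⟨hP.reg_mul hx (hP.reg_inv_of_not_reg hy), by
    rw [hP.ev_mul hx (hP.reg_inv_of_not_reg hy), hP.ev_inv_of_not_reg hy, mul_zero]⟩

/-- regular / unit [folklore] -/
theorem reg_div (hP : IsPlace K F Reg ev) {x y : K} (hx : Reg x) (hy : Reg y) (hy0 : ev y ≠ 0) :
    Reg (x / y) ∧ ev (x / y) = ev x / ev y := by
  rw [div_eq_mul_inv]
  exact ⟨hP.reg_mul hx (hP.reg_inv hy hy0), by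
    rw [hP.ev_mul hx (hP.reg_inv hy hy0), hP.ev_inv hy hy0, div_eq_mul_inv]⟩

/-- unit / m = pole [folklore] -/
theorem not_reg_div_of_unit_of_mem (hP : IsPlace K F Reg ev) {x y : K} (hx0 : ev x ≠ 0)
    (hy : Reg y) (hy0 : ev y = 0) (hyne : y ≠ 0) : ¬Reg (x / y) := by
  intro h
  -- x / y regular and y ∈ m would give x = (x/y) * y ∈ m
  have h1 : ev x = ev (x / y) * ev y := by
    rw [← hP.ev_mul h hy, div_mul_cancel₀ x hyne]
  rw [hy0, mul_zero] at h1
  exact hx0 h1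


/-- An element of non-zero value is non-zero. [folklore] -/
theorem ne_zero_of_ev_ne_zero (hP : IsPlace K F Reg ev) {x : K} (h : ev x ≠ 0) : x ≠ 0 := by
  rintro rfl
  exact h hP.ev_zero

/-- `1 - x⁻¹` is a unit when `x` is a generic unit. [folklore] -/
theorem ev_one_sub_inv (hP : IsPlace K F Reg ev) {x : K} (hx : Reg x) (h0 : ev x ≠ 0) :
    Reg (1 - x⁻¹) ∧ ev (1 - x⁻¹) = 1 - (ev x)⁻¹ :=
  ⟨hP.reg_one_sub (hP.reg_inv hx h0), by rw [hP.ev_one_sub (hP.reg_inv hx h0), hP.ev_inv hx h0]⟩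

/-! #### The five-term relation at a place: the seventeen cases

Notation in the comments: `m` = regular with value `0`, `1` = regular with value `1`,
`g` = regular with value `∉ {0,1}` (generic), `p` = not regular (pole). -/

section FiveTerm

/-- The fourth term of Neumann's relation is the product of the third and the fifth: `(1 - x⁻¹)/(1 - y⁻¹) = (y/x)·((1-x)/(1-y))`. [folklore] -/
theorem z4_eq {x y : K} (hx : x ≠ 0) (hy : y ≠ 0) (hy1 : y ≠ 1) :
    (1 - x⁻¹) / (1 - y⁻¹) = y / x * ((1 - x) / (1 - y)) := by
  have h1 : (1 : K) - y ≠ 0 := sub_ne_zero.2 (Ne.symm hy1)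
  have h2 : (y : K) - 1 ≠ 0 := sub_ne_zero.2 hy1
  field_simp
  ring

/-- Case `g g`, distinct values: a genuine five-term relation. [cite: DupontSah1982, §5, extended (5.3)] -/
theorem ft_gg_ne (hP : IsPlace K F Reg ev) {x y : K} (hx : Reg x) (ha0 : ev x ≠ 0)
    (ha1 : ev x ≠ 1) (hy : Reg y) (hb0 : ev y ≠ 0) (hb1 : ev y ≠ 1) (hab : ev x ≠ ev y) :
    placeSym Reg ev x - placeSym Reg ev y + placeSym Reg ev (y / x) -
      placeSym Reg ev ((1 - x⁻¹) / (1 - y⁻¹)) + placeSym Reg ev ((1 - x) / (1 - y)) = 0 := by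
  obtain ⟨r3, e3⟩ := hP.reg_div hy hx ha0
  have h1y0 : ev (1 - y) ≠ 0 := by
    rw [hP.ev_one_sub hy]
    exact sub_ne_zero.2 (Ne.symm hb1)
  obtain ⟨r5, e5⟩ := hP.reg_div (hP.reg_one_sub hx) (hP.reg_one_sub hy) h1y0
  obtain ⟨r1xi, e1xi⟩ := hP.ev_one_sub_inv hx ha0
  obtain ⟨r1yi, e1yi⟩ := hP.ev_one_sub_inv hy hb0
  have h1yi0 : ev (1 - y⁻¹) ≠ 0 := by
    rw [e1yi]
    exact sub_ne_zero.2 (Ne.symm (fun h => hb1 (inv_eq_one.1 h)))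
  obtain ⟨r4, e4⟩ := hP.reg_div r1xi r1yi h1yi0
  rw [placeSym_of_reg hx, placeSym_of_reg hy, placeSym_of_reg r3, placeSym_of_reg r4,
    placeSym_of_reg r5, e3, e4, e5, e1xi, e1yi, hP.ev_one_sub hx, hP.ev_one_sub hy]
  exact sym_five_term ⟨ha0, ha1⟩ ⟨hb0, hb1⟩ hab

/-- Case `g g`, equal values. [cite: DupontSah1982, §5, extended (5.3)] -/
theorem ft_gg_eq (hP : IsPlace K F Reg ev) {x y : K} (hx : Reg x) (ha0 : ev x ≠ 0)
    (ha1 : ev x ≠ 1) (hy : Reg y) (hab : ev x = ev y) :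
    placeSym Reg ev x - placeSym Reg ev y + placeSym Reg ev (y / x) -
      placeSym Reg ev ((1 - x⁻¹) / (1 - y⁻¹)) + placeSym Reg ev ((1 - x) / (1 - y)) = 0 := by
  have hb0 : ev y ≠ 0 := hab ▸ ha0
  have hb1 : ev y ≠ 1 := hab ▸ ha1
  obtain ⟨r3, e3⟩ := hP.reg_div hy hx ha0
  have h1y0 : ev (1 - y) ≠ 0 := by
    rw [hP.ev_one_sub hy]
    exact sub_ne_zero.2 (Ne.symm hb1)
  obtain ⟨r5, e5⟩ := hP.reg_div (hP.reg_one_sub hx) (hP.reg_one_sub hy) h1y0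
  obtain ⟨r1xi, e1xi⟩ := hP.ev_one_sub_inv hx ha0
  obtain ⟨r1yi, e1yi⟩ := hP.ev_one_sub_inv hy hb0
  have h1yi0 : ev (1 - y⁻¹) ≠ 0 := by
    rw [e1yi]
    exact sub_ne_zero.2 (Ne.symm (fun h => hb1 (inv_eq_one.1 h)))
  obtain ⟨r4, e4⟩ := hP.reg_div r1xi r1yi h1yi0
  rw [placeSym_of_reg hx, placeSym_of_reg hy, placeSym_of_reg r3, placeSym_of_reg r4,
    placeSym_of_reg r5, e3, e4, e5, e1xi, e1yi, hP.ev_one_sub hx, hP.ev_one_sub hy, hab,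
    div_self hb0, div_self (sub_ne_zero.2 (Ne.symm (fun h => hb1 (inv_eq_one.1 h)))),
    div_self (sub_ne_zero.2 (Ne.symm hb1)), sym_one]
  abel

/-- Case `m g`. [cite: DupontSah1982, §5, extended (5.3)] -/
theorem ft_mg [IsAlgClosed F] (hP : IsPlace K F Reg ev) {x y : K} (hxne : x ≠ 0) (hx : Reg x)
    (ha : ev x = 0) (hy : Reg y) (hb0 : ev y ≠ 0) (hb1 : ev y ≠ 1) :
    placeSym Reg ev x - placeSym Reg ev y + placeSym Reg ev (y / x) -
      placeSym Reg ev ((1 - x⁻¹) / (1 - y⁻¹)) + placeSym Reg ev ((1 - x) / (1 - y)) = 0 := by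
  have n3 : ¬Reg (y / x) := hP.not_reg_div_of_unit_of_mem hb0 hx ha hxne
  obtain ⟨r1yi, e1yi⟩ := hP.ev_one_sub_inv hy hb0
  have h1yi0 : ev (1 - y⁻¹) ≠ 0 := by
    rw [e1yi]
    exact sub_ne_zero.2 (Ne.symm (fun h => hb1 (inv_eq_one.1 h)))
  have n4 : ¬Reg ((1 - x⁻¹) / (1 - y⁻¹)) :=
    hP.not_reg_div_of_not_reg_of_unit (hP.not_reg_one_sub (hP.not_reg_inv hx ha hxne)) r1yi h1yi0
  have h1y0 : ev (1 - y) ≠ 0 := by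
    rw [hP.ev_one_sub hy]
    exact sub_ne_zero.2 (Ne.symm hb1)
  obtain ⟨r5, e5⟩ := hP.reg_div (hP.reg_one_sub hx) (hP.reg_one_sub hy) h1y0
  rw [placeSym_of_reg hx, placeSym_of_reg hy, placeSym_of_not_reg n3, placeSym_of_not_reg n4,
    placeSym_of_reg r5, e5, hP.ev_one_sub hx, hP.ev_one_sub hy, ha]
  simp only [sub_zero, one_div, sym_inv_one_sub, sym_zero]
  abel

/-- Case `g m`. [cite: DupontSah1982, §5, extended (5.3)] -/
theorem ft_gm [IsAlgClosed F] (hP : IsPlace K F Reg ev) {x y : K} (hyne : y ≠ 0) (hx : Reg x)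
    (ha0 : ev x ≠ 0) (hy : Reg y) (hb : ev y = 0) :
    placeSym Reg ev x - placeSym Reg ev y + placeSym Reg ev (y / x) -
      placeSym Reg ev ((1 - x⁻¹) / (1 - y⁻¹)) + placeSym Reg ev ((1 - x) / (1 - y)) = 0 := by
  obtain ⟨r3, e3⟩ := hP.reg_div hy hx ha0
  obtain ⟨r1xi, e1xi⟩ := hP.ev_one_sub_inv hx ha0
  obtain ⟨r4, e4⟩ := hP.reg_div_of_not_reg r1xi (hP.not_reg_one_sub (hP.not_reg_inv hy hb hyne))
  have h1y0 : ev (1 - y) ≠ 0 := by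
    rw [hP.ev_one_sub hy, hb, sub_zero]
    exact one_ne_zero
  obtain ⟨r5, e5⟩ := hP.reg_div (hP.reg_one_sub hx) (hP.reg_one_sub hy) h1y0
  rw [placeSym_of_reg hx, placeSym_of_reg hy, placeSym_of_reg r3, placeSym_of_reg r4,
    placeSym_of_reg r5, e3, e4, e5, hP.ev_one_sub hx, hP.ev_one_sub hy, hb, zero_div, sub_zero,
    div_one, sym_one_sub, sym_zero]
  abel

/-- Case `1 g`. [cite: DupontSah1982, §5, extended (5.3)] -/
theorem ft_1g (hP : IsPlace K F Reg ev) {x y : K} (hx : Reg x) (ha : ev x = 1) (hy : Reg y)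
    (hb0 : ev y ≠ 0) (hb1 : ev y ≠ 1) :
    placeSym Reg ev x - placeSym Reg ev y + placeSym Reg ev (y / x) -
      placeSym Reg ev ((1 - x⁻¹) / (1 - y⁻¹)) + placeSym Reg ev ((1 - x) / (1 - y)) = 0 := by
  have ha0 : ev x ≠ 0 := by
    rw [ha]
    exact one_ne_zero
  obtain ⟨r3, e3⟩ := hP.reg_div hy hx ha0
  obtain ⟨r1xi, e1xi⟩ := hP.ev_one_sub_inv hx ha0
  obtain ⟨r1yi, e1yi⟩ := hP.ev_one_sub_inv hy hb0
  have h1yi0 : ev (1 - y⁻¹) ≠ 0 := by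
    rw [e1yi]
    exact sub_ne_zero.2 (Ne.symm (fun h => hb1 (inv_eq_one.1 h)))
  obtain ⟨r4, e4⟩ := hP.reg_div r1xi r1yi h1yi0
  have h1y0 : ev (1 - y) ≠ 0 := by
    rw [hP.ev_one_sub hy]
    exact sub_ne_zero.2 (Ne.symm hb1)
  obtain ⟨r5, e5⟩ := hP.reg_div (hP.reg_one_sub hx) (hP.reg_one_sub hy) h1y0
  rw [placeSym_of_reg hx, placeSym_of_reg hy, placeSym_of_reg r3, placeSym_of_reg r4,
    placeSym_of_reg r5, e3, e4, e5, e1xi, hP.ev_one_sub hx, ha, div_one, inv_one, sub_self,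
    zero_div, zero_div, sym_one, sym_zero]
  abel

/-- Case `g 1`. [cite: DupontSah1982, §5, extended (5.3)] -/
theorem ft_g1 [IsAlgClosed F] (hP : IsPlace K F Reg ev) {x y : K} (hy1 : y ≠ 1) (hx : Reg x)
    (ha0 : ev x ≠ 0) (ha1 : ev x ≠ 1) (hy : Reg y) (hb : ev y = 1) :
    placeSym Reg ev x - placeSym Reg ev y + placeSym Reg ev (y / x) -
      placeSym Reg ev ((1 - x⁻¹) / (1 - y⁻¹)) + placeSym Reg ev ((1 - x) / (1 - y)) = 0 := by
  have hb0 : ev y ≠ 0 := by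
    rw [hb]
    exact one_ne_zero
  have hyne : y ≠ 0 := hP.ne_zero_of_ev_ne_zero hb0
  obtain ⟨r3, e3⟩ := hP.reg_div hy hx ha0
  obtain ⟨r1xi, e1xi⟩ := hP.ev_one_sub_inv hx ha0
  obtain ⟨r1yi, e1yi⟩ := hP.ev_one_sub_inv hy hb0
  have h1xi0 : ev (1 - x⁻¹) ≠ 0 := by
    rw [e1xi]
    exact sub_ne_zero.2 (Ne.symm (fun h => ha1 (inv_eq_one.1 h)))
  have h1yi : ev (1 - y⁻¹) = 0 := by rw [e1yi, hb, inv_one, sub_self]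
  have n4 : ¬Reg ((1 - x⁻¹) / (1 - y⁻¹)) :=
    hP.not_reg_div_of_unit_of_mem h1xi0 r1yi h1yi (sub_ne_zero.2 (Ne.symm (fun h => hy1
      (inv_eq_one.1 h))))
  have h1y : ev (1 - y) = 0 := by rw [hP.ev_one_sub hy, hb, sub_self]
  have h1x0 : ev (1 - x) ≠ 0 := by
    rw [hP.ev_one_sub hx]
    exact sub_ne_zero.2 (Ne.symm ha1)
  have n5 : ¬Reg ((1 - x) / (1 - y)) :=
    hP.not_reg_div_of_unit_of_mem h1x0 (hP.reg_one_sub hy) h1y (sub_ne_zero.2 (Ne.symm hy1))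
  rw [placeSym_of_reg hx, placeSym_of_reg hy, placeSym_of_reg r3, placeSym_of_not_reg n4,
    placeSym_of_not_reg n5, e3, hb, one_div, sym_inv, sym_one]
  abel

/-- Case `p g`. [cite: DupontSah1982, §5, extended (5.3)] -/
theorem ft_pg [IsAlgClosed F] (hP : IsPlace K F Reg ev) {x y : K} (hx : ¬Reg x) (hy : Reg y)
    (hb0 : ev y ≠ 0) (hb1 : ev y ≠ 1) :
    placeSym Reg ev x - placeSym Reg ev y + placeSym Reg ev (y / x) -
      placeSym Reg ev ((1 - x⁻¹) / (1 - y⁻¹)) + placeSym Reg ev ((1 - x) / (1 - y)) = 0 := by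
  obtain ⟨r3, e3⟩ := hP.reg_div_of_not_reg hy hx
  have rxi := hP.reg_inv_of_not_reg hx
  have exi := hP.ev_inv_of_not_reg hx
  have e1xi : ev (1 - x⁻¹) = 1 := by rw [hP.ev_one_sub rxi, exi, sub_zero]
  obtain ⟨r1yi, e1yi⟩ := hP.ev_one_sub_inv hy hb0
  have h1yi0 : ev (1 - y⁻¹) ≠ 0 := by
    rw [e1yi]
    exact sub_ne_zero.2 (Ne.symm (fun h => hb1 (inv_eq_one.1 h)))
  obtain ⟨r4, e4⟩ := hP.reg_div (hP.reg_one_sub rxi) r1yi h1yi0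
  have h1y0 : ev (1 - y) ≠ 0 := by
    rw [hP.ev_one_sub hy]
    exact sub_ne_zero.2 (Ne.symm hb1)
  have n5 : ¬Reg ((1 - x) / (1 - y)) :=
    hP.not_reg_div_of_not_reg_of_unit (hP.not_reg_one_sub hx) (hP.reg_one_sub hy) h1y0
  rw [placeSym_of_not_reg hx, placeSym_of_reg hy, placeSym_of_reg r3, placeSym_of_reg r4,
    placeSym_of_not_reg n5, e3, e4, e1xi, e1yi, one_div, sym_inv_one_sub, sym_inv, sym_zero]
  abel

/-- Case `g p`. [cite: DupontSah1982, §5, extended (5.3)] -/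
theorem ft_gp [IsAlgClosed F] (hP : IsPlace K F Reg ev) {x y : K} (hx : Reg x) (ha0 : ev x ≠ 0)
    (hy : ¬Reg y) :
    placeSym Reg ev x - placeSym Reg ev y + placeSym Reg ev (y / x) -
      placeSym Reg ev ((1 - x⁻¹) / (1 - y⁻¹)) + placeSym Reg ev ((1 - x) / (1 - y)) = 0 := by
  have n3 : ¬Reg (y / x) := hP.not_reg_div_of_not_reg_of_unit hy hx ha0
  obtain ⟨r1xi, e1xi⟩ := hP.ev_one_sub_inv hx ha0
  have ryi := hP.reg_inv_of_not_reg hy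
  have e1yi : ev (1 - y⁻¹) = 1 := by rw [hP.ev_one_sub ryi, hP.ev_inv_of_not_reg hy, sub_zero]
  obtain ⟨r4, e4⟩ := hP.reg_div r1xi (hP.reg_one_sub ryi) (by rw [e1yi]; exact one_ne_zero)
  obtain ⟨r5, e5⟩ := hP.reg_div_of_not_reg (hP.reg_one_sub hx) (hP.not_reg_one_sub hy)
  rw [placeSym_of_reg hx, placeSym_of_not_reg hy, placeSym_of_not_reg n3, placeSym_of_reg r4,
    placeSym_of_reg r5, e4, e5, e1xi, e1yi, div_one, sym_one_sub_inv, sym_zero]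
  abel

/-- Case `m m`: `z₄ = z₃ · z₅` with `z₅` a unit of value `1`. [cite: DupontSah1982, §5, extended (5.3)] -/
theorem ft_mm (hP : IsPlace K F Reg ev) {x y : K} (hxne : x ≠ 0) (hyne : y ≠ 0) (hy1 : y ≠ 1)
    (hx : Reg x) (ha : ev x = 0) (hy : Reg y) (hb : ev y = 0) :
    placeSym Reg ev x - placeSym Reg ev y + placeSym Reg ev (y / x) -
      placeSym Reg ev ((1 - x⁻¹) / (1 - y⁻¹)) + placeSym Reg ev ((1 - x) / (1 - y)) = 0 := by
  have h1y : ev (1 - y) = 1 := by rw [hP.ev_one_sub hy, hb, sub_zero]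
  obtain ⟨r5, e5⟩ := hP.reg_div (hP.reg_one_sub hx) (hP.reg_one_sub hy)
    (by rw [h1y]; exact one_ne_zero)
  have e5' : ev ((1 - x) / (1 - y)) = 1 := by
    rw [e5, hP.ev_one_sub hx, h1y, ha, sub_zero, div_one]
  have h4 : placeSym Reg ev ((1 - x⁻¹) / (1 - y⁻¹)) = placeSym Reg ev (y / x) := by
    rw [z4_eq hxne hyne hy1]
    by_cases r3 : Reg (y / x)
    · rw [placeSym_of_reg (hP.reg_mul r3 r5), placeSym_of_reg r3, hP.ev_mul r3 r5, e5', mul_one]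
    · rw [placeSym_of_not_reg r3, placeSym_of_not_reg
        (hP.not_reg_mul_of_not_reg_of_unit r3 r5 (by rw [e5']; exact one_ne_zero))]
  rw [h4, placeSym_of_reg hx, placeSym_of_reg hy, placeSym_of_reg r5, e5', ha, hb, sym_zero,
    sym_one]
  abel

/-- Case `1 1`: `z₄ = z₃ · z₅` with `z₃` a unit of value `1`. [cite: DupontSah1982, §5, extended (5.3)] -/
theorem ft_11 (hP : IsPlace K F Reg ev) {x y : K} (hxne : x ≠ 0) (hyne : y ≠ 0) (hy1 : y ≠ 1)
    (hx : Reg x) (ha : ev x = 1) (hy : Reg y) (hb : ev y = 1) :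
    placeSym Reg ev x - placeSym Reg ev y + placeSym Reg ev (y / x) -
      placeSym Reg ev ((1 - x⁻¹) / (1 - y⁻¹)) + placeSym Reg ev ((1 - x) / (1 - y)) = 0 := by
  obtain ⟨r3, e3⟩ := hP.reg_div hy hx (by rw [ha]; exact one_ne_zero)
  have e3' : ev (y / x) = 1 := by rw [e3, ha, hb, div_one]
  have h4 : placeSym Reg ev ((1 - x⁻¹) / (1 - y⁻¹)) = placeSym Reg ev ((1 - x) / (1 - y)) := by
    rw [z4_eq hxne hyne hy1]
    by_cases r5 : Reg ((1 - x) / (1 - y))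
    · rw [placeSym_of_reg (hP.reg_mul r3 r5), placeSym_of_reg r5, hP.ev_mul r3 r5, e3', one_mul]
    · rw [placeSym_of_not_reg r5, mul_comm, placeSym_of_not_reg
        (hP.not_reg_mul_of_not_reg_of_unit r5 r3 (by rw [e3']; exact one_ne_zero))]
  rw [h4, placeSym_of_reg hx, placeSym_of_reg hy, placeSym_of_reg r3, e3', ha, hb, sym_one]
  abel

/-- Case `p p`: `z₄` is a unit of value `1` and `z₅ = z₄ · (y/x)⁻¹`. [cite: DupontSah1982, §5, extended (5.3)] -/
theorem ft_pp [IsAlgClosed F] (hP : IsPlace K F Reg ev) {x y : K} (hy1 : y ≠ 1) (hx : ¬Reg x)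
    (hy : ¬Reg y) :
    placeSym Reg ev x - placeSym Reg ev y + placeSym Reg ev (y / x) -
      placeSym Reg ev ((1 - x⁻¹) / (1 - y⁻¹)) + placeSym Reg ev ((1 - x) / (1 - y)) = 0 := by
  have hxne := hP.ne_zero_of_not_reg hx
  have hyne := hP.ne_zero_of_not_reg hy
  have rxi := hP.reg_inv_of_not_reg hx
  have ryi := hP.reg_inv_of_not_reg hy
  have e1xi : ev (1 - x⁻¹) = 1 := by rw [hP.ev_one_sub rxi, hP.ev_inv_of_not_reg hx, sub_zero]
  have e1yi : ev (1 - y⁻¹) = 1 := by rw [hP.ev_one_sub ryi, hP.ev_inv_of_not_reg hy, sub_zero]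
  obtain ⟨r4, e4⟩ := hP.reg_div (hP.reg_one_sub rxi) (hP.reg_one_sub ryi)
    (by rw [e1yi]; exact one_ne_zero)
  have e4' : ev ((1 - x⁻¹) / (1 - y⁻¹)) = 1 := by rw [e4, e1xi, e1yi, div_one]
  have hz5 : (1 - x) / (1 - y) = (1 - x⁻¹) / (1 - y⁻¹) * (y / x)⁻¹ := by
    rw [z4_eq hxne hyne hy1, mul_comm (y / x) _, mul_assoc, mul_inv_cancel₀ (div_ne_zero hyne hxne),
      mul_one]
  have h35 : placeSym Reg ev (y / x) + placeSym Reg ev ((1 - x) / (1 - y)) = 0 := by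
    rw [hz5]
    by_cases r3 : Reg (y / x)
    · by_cases e3 : ev (y / x) = 0
      · rw [placeSym_of_reg r3, e3, sym_zero, placeSym_of_not_reg (hP.not_reg_mul_of_not_reg_of_unit
          (hP.not_reg_inv r3 e3 (div_ne_zero hyne hxne)) r4 (by rw [e4']; exact one_ne_zero)
          ∘ fun h => by rwa [mul_comm] at h), add_zero]
      · rw [placeSym_of_reg r3, placeSym_of_reg (hP.reg_mul r4 (hP.reg_inv r3 e3)),
          hP.ev_mul r4 (hP.reg_inv r3 e3), e4', one_mul, hP.ev_inv r3 e3, sym_add_sym_inv]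
    · have ri := hP.reg_inv_of_not_reg r3
      rw [placeSym_of_not_reg r3, placeSym_of_reg (hP.reg_mul r4 ri), hP.ev_mul r4 ri,
        hP.ev_inv_of_not_reg r3, mul_zero, sym_zero, add_zero]
  rw [placeSym_of_not_reg hx, placeSym_of_not_reg hy, placeSym_of_reg r4, e4', sym_one]
  linear_combination (norm := abel) h35

/-- Case `m 1`. [cite: DupontSah1982, §5, extended (5.3)] -/
theorem ft_m1 (hP : IsPlace K F Reg ev) {x y : K} (hxne : x ≠ 0) (hy1 : y ≠ 1) (hx : Reg x)
    (ha : ev x = 0) (hy : Reg y) (hb : ev y = 1) :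
    placeSym Reg ev x - placeSym Reg ev y + placeSym Reg ev (y / x) -
      placeSym Reg ev ((1 - x⁻¹) / (1 - y⁻¹)) + placeSym Reg ev ((1 - x) / (1 - y)) = 0 := by
  have hb0 : ev y ≠ 0 := by
    rw [hb]
    exact one_ne_zero
  have hyne : y ≠ 0 := hP.ne_zero_of_ev_ne_zero hb0
  have n3 : ¬Reg (y / x) := hP.not_reg_div_of_unit_of_mem hb0 hx ha hxne
  obtain ⟨r1yi, e1yi⟩ := hP.ev_one_sub_inv hy hb0
  have h1yi : ev (1 - y⁻¹) = 0 := by rw [e1yi, hb, inv_one, sub_self]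
  have h1yine : (1 : K) - y⁻¹ ≠ 0 := sub_ne_zero.2 (Ne.symm (fun h => hy1 (inv_eq_one.1 h)))
  have n4 : ¬Reg ((1 - x⁻¹) / (1 - y⁻¹)) := by
    rw [div_eq_mul_inv]
    exact hP.not_reg_mul_of_not_reg (hP.not_reg_one_sub (hP.not_reg_inv hx ha hxne))
      (hP.not_reg_inv r1yi h1yi h1yine)
  have h1x0 : ev (1 - x) ≠ 0 := by
    rw [hP.ev_one_sub hx, ha, sub_zero]
    exact one_ne_zero
  have n5 : ¬Reg ((1 - x) / (1 - y)) :=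
    hP.not_reg_div_of_unit_of_mem h1x0 (hP.reg_one_sub hy)
      (by rw [hP.ev_one_sub hy, hb, sub_self]) (sub_ne_zero.2 (Ne.symm hy1))
  rw [placeSym_of_reg hx, placeSym_of_reg hy, placeSym_of_not_reg n3, placeSym_of_not_reg n4,
    placeSym_of_not_reg n5, ha, hb, sym_zero, sym_one]
  abel

/-- Case `1 m`. [cite: DupontSah1982, §5, extended (5.3)] -/
theorem ft_1m (hP : IsPlace K F Reg ev) {x y : K} (hyne : y ≠ 0) (hx : Reg x) (ha : ev x = 1)
    (hy : Reg y) (hb : ev y = 0) :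
    placeSym Reg ev x - placeSym Reg ev y + placeSym Reg ev (y / x) -
      placeSym Reg ev ((1 - x⁻¹) / (1 - y⁻¹)) + placeSym Reg ev ((1 - x) / (1 - y)) = 0 := by
  have ha0 : ev x ≠ 0 := by
    rw [ha]
    exact one_ne_zero
  obtain ⟨r3, e3⟩ := hP.reg_div hy hx ha0
  obtain ⟨r1xi, e1xi⟩ := hP.ev_one_sub_inv hx ha0
  obtain ⟨r4, e4⟩ := hP.reg_div_of_not_reg r1xi (hP.not_reg_one_sub (hP.not_reg_inv hy hb hyne))
  obtain ⟨r5, e5⟩ := hP.reg_div (hP.reg_one_sub hx) (hP.reg_one_sub hy)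
    (by rw [hP.ev_one_sub hy, hb, sub_zero]; exact one_ne_zero)
  rw [placeSym_of_reg hx, placeSym_of_reg hy, placeSym_of_reg r3, placeSym_of_reg r4,
    placeSym_of_reg r5, e3, e4, e5, hP.ev_one_sub hx, ha, hb, zero_div, sub_self, zero_div,
    sym_zero, sym_one]
  abel

/-- Case `m p`. [cite: DupontSah1982, §5, extended (5.3)] -/
theorem ft_mp (hP : IsPlace K F Reg ev) {x y : K} (hxne : x ≠ 0) (hx : Reg x) (ha : ev x = 0)
    (hy : ¬Reg y) :
    placeSym Reg ev x - placeSym Reg ev y + placeSym Reg ev (y / x) -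
      placeSym Reg ev ((1 - x⁻¹) / (1 - y⁻¹)) + placeSym Reg ev ((1 - x) / (1 - y)) = 0 := by
  have n3 : ¬Reg (y / x) := by
    rw [div_eq_mul_inv]
    exact hP.not_reg_mul_of_not_reg hy (hP.not_reg_inv hx ha hxne)
  have ryi := hP.reg_inv_of_not_reg hy
  have e1yi : ev (1 - y⁻¹) = 1 := by rw [hP.ev_one_sub ryi, hP.ev_inv_of_not_reg hy, sub_zero]
  have n4 : ¬Reg ((1 - x⁻¹) / (1 - y⁻¹)) :=
    hP.not_reg_div_of_not_reg_of_unit (hP.not_reg_one_sub (hP.not_reg_inv hx ha hxne))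
      (hP.reg_one_sub ryi) (by rw [e1yi]; exact one_ne_zero)
  obtain ⟨r5, e5⟩ := hP.reg_div_of_not_reg (hP.reg_one_sub hx) (hP.not_reg_one_sub hy)
  rw [placeSym_of_reg hx, placeSym_of_not_reg hy, placeSym_of_not_reg n3, placeSym_of_not_reg n4,
    placeSym_of_reg r5, e5, ha, sym_zero]
  abel

/-- Case `p m`. [cite: DupontSah1982, §5, extended (5.3)] -/
theorem ft_pm (hP : IsPlace K F Reg ev) {x y : K} (hx : ¬Reg x) (hy : Reg y) (hb : ev y = 0) :
    placeSym Reg ev x - placeSym Reg ev y + placeSym Reg ev (y / x) -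
      placeSym Reg ev ((1 - x⁻¹) / (1 - y⁻¹)) + placeSym Reg ev ((1 - x) / (1 - y)) = 0 := by
  obtain ⟨r3, e3⟩ := hP.reg_div_of_not_reg hy hx
  have rxi := hP.reg_inv_of_not_reg hx
  by_cases hyne : y = 0
  · subst hyne
    have n5 : ¬Reg ((1 - x) / (1 - 0)) := by
      rw [sub_zero, div_one]
      exact hP.not_reg_one_sub hx
    have e4 : placeSym Reg ev ((1 - x⁻¹) / (1 - (0 : K)⁻¹)) = 0 := by
      rw [inv_zero, sub_zero, div_one, placeSym_of_reg (hP.reg_one_sub rxi), hP.ev_one_sub rxi,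
        hP.ev_inv_of_not_reg hx, sub_zero, sym_one]
    rw [placeSym_of_not_reg hx, placeSym_of_reg hy, placeSym_of_reg r3, placeSym_of_not_reg n5,
      e4, e3, hb, sym_zero]
    abel
  obtain ⟨r4, e4⟩ := hP.reg_div_of_not_reg (hP.reg_one_sub rxi)
    (hP.not_reg_one_sub (hP.not_reg_inv hy hb hyne))
  have n5 : ¬Reg ((1 - x) / (1 - y)) :=
    hP.not_reg_div_of_not_reg_of_unit (hP.not_reg_one_sub hx) (hP.reg_one_sub hy)
      (by rw [hP.ev_one_sub hy, hb, sub_zero]; exact one_ne_zero)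
  rw [placeSym_of_not_reg hx, placeSym_of_reg hy, placeSym_of_reg r3, placeSym_of_reg r4,
    placeSym_of_not_reg n5, e3, e4, hb, sym_zero]
  abel

/-- Case `1 p`. [cite: DupontSah1982, §5, extended (5.3)] -/
theorem ft_1p (hP : IsPlace K F Reg ev) {x y : K} (hx : Reg x) (ha : ev x = 1) (hy : ¬Reg y) :
    placeSym Reg ev x - placeSym Reg ev y + placeSym Reg ev (y / x) -
      placeSym Reg ev ((1 - x⁻¹) / (1 - y⁻¹)) + placeSym Reg ev ((1 - x) / (1 - y)) = 0 := by
  have ha0 : ev x ≠ 0 := by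
    rw [ha]
    exact one_ne_zero
  have n3 : ¬Reg (y / x) := hP.not_reg_div_of_not_reg_of_unit hy hx ha0
  obtain ⟨r1xi, e1xi⟩ := hP.ev_one_sub_inv hx ha0
  have ryi := hP.reg_inv_of_not_reg hy
  have e1yi : ev (1 - y⁻¹) = 1 := by rw [hP.ev_one_sub ryi, hP.ev_inv_of_not_reg hy, sub_zero]
  obtain ⟨r4, e4⟩ := hP.reg_div r1xi (hP.reg_one_sub ryi) (by rw [e1yi]; exact one_ne_zero)
  obtain ⟨r5, e5⟩ := hP.reg_div_of_not_reg (hP.reg_one_sub hx) (hP.not_reg_one_sub hy)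
  rw [placeSym_of_reg hx, placeSym_of_not_reg hy, placeSym_of_not_reg n3, placeSym_of_reg r4,
    placeSym_of_reg r5, e4, e5, e1xi, e1yi, ha, inv_one, sub_self, zero_div, sym_zero, sym_one]
  abel

/-- Case `p 1`. [cite: DupontSah1982, §5, extended (5.3)] -/
theorem ft_p1 (hP : IsPlace K F Reg ev) {x y : K} (hy1 : y ≠ 1) (hx : ¬Reg x) (hy : Reg y)
    (hb : ev y = 1) :
    placeSym Reg ev x - placeSym Reg ev y + placeSym Reg ev (y / x) -
      placeSym Reg ev ((1 - x⁻¹) / (1 - y⁻¹)) + placeSym Reg ev ((1 - x) / (1 - y)) = 0 := by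
  have hb0 : ev y ≠ 0 := by
    rw [hb]
    exact one_ne_zero
  obtain ⟨r3, e3⟩ := hP.reg_div_of_not_reg hy hx
  have rxi := hP.reg_inv_of_not_reg hx
  have e1xi : ev (1 - x⁻¹) = 1 := by rw [hP.ev_one_sub rxi, hP.ev_inv_of_not_reg hx, sub_zero]
  obtain ⟨r1yi, e1yi⟩ := hP.ev_one_sub_inv hy hb0
  have h1yi : ev (1 - y⁻¹) = 0 := by rw [e1yi, hb, inv_one, sub_self]
  have n4 : ¬Reg ((1 - x⁻¹) / (1 - y⁻¹)) :=
    hP.not_reg_div_of_unit_of_mem (by rw [e1xi]; exact one_ne_zero) r1yi h1yi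
      (sub_ne_zero.2 (Ne.symm (fun h => hy1 (inv_eq_one.1 h))))
  have n5 : ¬Reg ((1 - x) / (1 - y)) := by
    rw [div_eq_mul_inv]
    exact hP.not_reg_mul_of_not_reg (hP.not_reg_one_sub hx)
      (hP.not_reg_inv (hP.reg_one_sub hy) (by rw [hP.ev_one_sub hy, hb, sub_self])
        (sub_ne_zero.2 (Ne.symm hy1)))
  rw [placeSym_of_not_reg hx, placeSym_of_reg hy, placeSym_of_reg r3, placeSym_of_not_reg n4,
    placeSym_of_not_reg n5, e3, hb, sym_zero, sym_one]
  abel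

/-- **The five-term relation specializes at a place** (`F` algebraically closed): for `x ≠ y` in
`K ∖ {0, 1}`, the symbols at the place of the five terms of Neumann's relation sum to zero in
`P(F)`; this is the content of "the five-term relation remains valid for `zᵢ ∈ F ∪ {∞}`"
(Dupont p. 43; Dupont–Sah §5, "the extended form of (5.3)"). [cite: Dupont2001, (8.13)] -/
theorem five_term [IsAlgClosed F] (hP : IsPlace K F Reg ev) {x y : K} (hx0 : x ≠ 0)
    (hy0 : y ≠ 0) (hy1 : y ≠ 1) :
    placeSym Reg ev x - placeSym Reg ev y + placeSym Reg ev (y / x) -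
      placeSym Reg ev ((1 - x⁻¹) / (1 - y⁻¹)) + placeSym Reg ev ((1 - x) / (1 - y)) = 0 := by
  by_cases hx : Reg x
  · by_cases ha0 : ev x = 0
    · by_cases hy : Reg y
      · by_cases hb0 : ev y = 0
        · exact hP.ft_mm hx0 hy0 hy1 hx ha0 hy hb0
        by_cases hb1 : ev y = 1
        · exact hP.ft_m1 hx0 hy1 hx ha0 hy hb1
        · exact hP.ft_mg hx0 hx ha0 hy hb0 hb1
      · exact hP.ft_mp hx0 hx ha0 hy
    by_cases ha1 : ev x = 1
    · by_cases hy : Reg y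
      · by_cases hb0 : ev y = 0
        · exact hP.ft_1m hy0 hx ha1 hy hb0
        by_cases hb1 : ev y = 1
        · exact hP.ft_11 hx0 hy0 hy1 hx ha1 hy hb1
        · exact hP.ft_1g hx ha1 hy hb0 hb1
      · exact hP.ft_1p hx ha1 hy
    · by_cases hy : Reg y
      · by_cases hb0 : ev y = 0
        · exact hP.ft_gm hy0 hx ha0 hy hb0
        by_cases hb1 : ev y = 1
        · exact hP.ft_g1 hy1 hx ha0 ha1 hy hb1
        by_cases hab : ev x = ev y
        · exact hP.ft_gg_eq hx ha0 ha1 hy hab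
        · exact hP.ft_gg_ne hx ha0 ha1 hy hb0 hb1 hab
      · exact hP.ft_gp hx ha0 hy
  · by_cases hy : Reg y
    · by_cases hb0 : ev y = 0
      · exact hP.ft_pm hx hy hb0
      by_cases hb1 : ev y = 1
      · exact hP.ft_p1 hy1 hx hy hb1
      · exact hP.ft_pg hx hy hb0 hb1
    · exact hP.ft_pp hy1 hx hy


end FiveTerm

end IsPlace

end PreBloch

end Literature.NumberTheory.Transcendental
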